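import Mathlib
import HarnessLib

/-!
# FunctionalMining/NoGo — two notches: arithmetic cores of the EPISODE BUDGET (COLLAPSE-ADDENDUM-4 §Q″,
# PROPOSITION F15a (2), COROLLARY F15b, COROLLARY F15d), staged by the no-go seat (cell `pub-nsfunc`, nogo gen 16)

Search for candidate a priori estimates; no regularity claim. The planner seat cannot file under
`FunctionalMining/`; this file is STAGED for the prove seat, in the style of `NoGo/OneNotchRangeCollapse.lean`.

Setting (informal; strict two-notch rule book, sizes `d > t > u > 0`, `η₂ = t − u`, exact straight-chord
kinematics `dx/dy = −tan(mid)`): an EPISODE is a `−u` sitting right-adjacent to its `−d` main `M` when `M`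
next creates (type A, putting `r = +t` next to `M`); F15a says the gap `G` between `r` and that `u` at birth is
at least `((d+u)/2)·g` (`g` = the creation gap of the episode) and closes at rate at most `(η₂/2)·S`
(`S = sec² θ_∞ ≥ 1`), so `r` lives at least `K·g`, `K = (d+u)/(η₂·S)`; F15b bounds every lifetime in the
channel by `⌈n_R/N⌉·Y` (FIFO + periodicity), whence `g < ⌈n_R/N⌉·Y/K`; F15d feeds the two budgets of the
smallest u-staircase walk (`n_R = 4`, `N = 2`: `g < 2Y/K`, and the time-reversed dual) into
`(y₃ − y₂) + (y₅ − y₄) ≤ Y` and gets a contradiction for `K ≥ 4`.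

What is formalised (everything elementary real arithmetic, `[ours]`); the kinematic/combinatorial layer
(chords, events, FIFO, periodicity, time reversal) stays prose:
* `episode_gap_lb` — F15a (1): rates `≥ c` on `[a,e]` and `[e,b]` ⇒ gap `≥ c·(b − a)` at `b`.
* `episode_duration_lb` — F15a (2): `G ≥ ((d+u)/2)·g`, `G = rate·T`, `0 < rate ≤ (η/2)·S` ⇒ `T ≥ ((d+u)/(η·S))·g`.
* `fifo_lifetime`, `periodic_births`, `fifo_lifetime_periodic` — F15b's combinatorial half: FIFO births/deaths,
  at most `n` alive, births `Y`-periodic with period `N` in the index, `n ≤ m·N` ⇒ every lifetime `≤ m·Y`.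
* `episode_gap_budget` — F15b: `K·g < L ≤ m·Y` ⇒ `g < m·Y/K`.
* `f15d_step`, `f15d_contradiction` — F15d: `g = Y + y₄ − y₅ < 2Y/K` ⇒ `y₅ − y₄ > (1 − 2/K)·Y`; two such
  gaps summing to at most `Y` are impossible once `K ≥ 4`.
* `f15d_prime_p1`, `f15d_prime_p2` — F15d′: with the walk's exact events (r's first absorption, r̄'s last
  emission) both walks of record are dead for every `K > 1`.
* `K_at_record_sizes` — `(d+u)/η₂ = 18` at the sizes `(.2, .18, .16)` of record.
Nothing is claimed about Navier–Stokes.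
-/

namespace Summit.NavierStokesRegularity.FunctionalMining.TwoNotch

/-- F15a (1), arithmetic core: a gap opening at rates `r₁ ≥ c` on `[a, e]` and `r₂ ≥ c` on `[e, b]`
(`c = (d+u)/2` in the text) is at least `c·(b − a)` at height `b`. -/
theorem episode_gap_lb {c r₁ r₂ a e b G₀ G : ℝ} (hG₀ : 0 ≤ G₀) (h1 : c ≤ r₁) (h2 : c ≤ r₂)
    (hae : a ≤ e) (heb : e ≤ b) (hG : G = G₀ + r₁ * (e - a) + r₂ * (b - e)) :
    c * (b - a) ≤ G := by
  have k1 : c * (e - a) ≤ r₁ * (e - a) := mul_le_mul_of_nonneg_right h1 (by linarith)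
  have k2 : c * (b - e) ≤ r₂ * (b - e) := mul_le_mul_of_nonneg_right h2 (by linarith)
  have k3 : c * (b - a) = c * (e - a) + c * (b - e) := by ring
  linarith

/-- F15a (2), arithmetic core: a gap of size at least `((d+u)/2)·g` closing at a rate at most `(η/2)·S`
takes time at least `((d+u)/(η·S))·g`. -/
theorem episode_duration_lb {d u η S g G rate T : ℝ} (hd : 0 < d) (hu : 0 < u) (hη : 0 < η)
    (hS : 1 ≤ S) (hg : 0 ≤ g) (hG : (d + u) / 2 * g ≤ G) (hrate : 0 < rate)
    (hrate' : rate ≤ η / 2 * S) (hT : G = rate * T) :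
    (d + u) / (η * S) * g ≤ T := by
  have hηS : 0 < η * S := by positivity
  have h2 : 0 ≤ (d + u) / 2 * g := mul_nonneg (by positivity) hg
  have hT0 : 0 ≤ T := by
    have h0 : 0 ≤ rate * T := by linarith
    nlinarith [h0, hrate]
  rw [div_mul_eq_mul_div, div_le_iff₀ hηS]
  have h3 : 0 ≤ T * (η / 2 * S - rate) := mul_nonneg hT0 (by linarith)
  nlinarith

/-- F15b, arithmetic core: `K·g < lifetime ≤ m·Y` gives the episode budget `g < m·Y/K`. -/
theorem episode_gap_budget {K g L m Y : ℝ} (hK : 0 < K) (h1 : K * g < L) (h2 : L ≤ m * Y) :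
    g < m * Y / K := by
  rw [lt_div_iff₀ hK]
  linarith [mul_comm K g]

/-- F15b, combinatorial core (FIFO lifetime bound): if births `β` and deaths `δ` along a channel are both
monotone in the birth index (FIFO) and at most `n` chords are ever alive simultaneously, then the `j`-th chord
is dead by the `(j+n)`-th birth. -/
theorem fifo_lifetime (n : ℕ) (β δ : ℕ → ℝ) (hβ : Monotone β) (hδ : Monotone δ)
    (hcap : ∀ y : ℝ, ∀ s : Finset ℕ, (∀ i ∈ s, β i ≤ y ∧ y < δ i) → s.card ≤ n) (j : ℕ) :
    δ j ≤ β (j + n) := by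
  by_contra h
  rw [not_le] at h
  have hc := hcap (β (j + n)) (Finset.Icc j (j + n)) (by
    intro i hi
    rw [Finset.mem_Icc] at hi
    exact ⟨hβ hi.2, lt_of_lt_of_le h (hδ hi.1)⟩)
  rw [Nat.card_Icc] at hc
  omega

/-- Periodic births: `β (j + N) = β j + Y` for all `j` gives `β (j + m·N) = β j + m·Y`. -/
theorem periodic_births (β : ℕ → ℝ) (N : ℕ) (Y : ℝ) (h : ∀ j, β (j + N) = β j + Y) (j m : ℕ) :
    β (j + m * N) = β j + m * Y := by
  induction m with
  | zero => simp
  | succ k ih =>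
    have : j + (k + 1) * N = (j + k * N) + N := by ring
    rw [this, h, ih]; push_cast; ring

/-- F15b assembled: FIFO + capacity `n` + periodic births with `n ≤ m·N` bound every lifetime by `m·Y`
(`m = ⌈n_R/N⌉` in the text). -/
theorem fifo_lifetime_periodic (n N m : ℕ) (β δ : ℕ → ℝ) (Y : ℝ) (hβ : Monotone β) (hδ : Monotone δ)
    (hcap : ∀ y : ℝ, ∀ s : Finset ℕ, (∀ i ∈ s, β i ≤ y ∧ y < δ i) → s.card ≤ n)
    (hper : ∀ j, β (j + N) = β j + Y) (hm : n ≤ m * N) (j : ℕ) :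
    δ j - β j ≤ m * Y := by
  have h1 := fifo_lifetime n β δ hβ hδ hcap j
  have h2 : β (j + n) ≤ β (j + m * N) := hβ (by omega)
  have h3 := periodic_births β N Y hper j m
  linarith

/-- F15d, first step: an episode gap `g = Y + y₄ − y₅` (M creates A at `y₄`, B at `y₅`, next A at `y₄ + Y`)
under the budget `g < 2Y/K` forces `y₅ − y₄ > (1 − 2/K)·Y`. -/
theorem f15d_step {K Y g y4 y5 : ℝ} (hg : g = Y + y4 - y5) (hb : g < 2 * Y / K) :
    (1 - 2 / K) * Y < y5 - y4 := by
  have : (1 - 2 / K) * Y = Y - 2 * Y / K := by ring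
  linarith

/-- F15d, contradiction: two gaps each exceeding `(1 − 2/K)·Y` cannot sum to at most `Y` when `K ≥ 4`. -/
theorem f15d_contradiction {K Y a b : ℝ} (hK : 4 ≤ K) (hY : 0 < Y)
    (ha : (1 - 2 / K) * Y < a) (hb : (1 - 2 / K) * Y < b) (hab : a + b ≤ Y) : False := by
  have hK0 : 0 < K := by linarith
  have h2K : 2 / K ≤ 1 / 2 := by
    rw [div_le_iff₀ hK0]
    linarith
  have hhalf : Y / 2 ≤ (1 - 2 / K) * Y := by nlinarith
  linarith

/-- The smallest u-staircase walks of record die on paper once `K ≥ 4` (F15d): packaged form. -/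
theorem f15d_walk_of_record {K Y y2 y3 y4 y5 gM gP : ℝ} (hK : 4 ≤ K) (hY : 0 < Y)
    (hgM : gM = Y + y4 - y5) (hbM : gM < 2 * Y / K)
    (hgP : gP = Y + y2 - y3) (hbP : gP < 2 * Y / K)
    (hsum : (y3 - y2) + (y5 - y4) ≤ Y) : False :=
  f15d_contradiction hK hY (f15d_step hgP hbP) (f15d_step hgM hbM) hsum

/-- F15d′ (exact events), p = 1 walk of record: F15a (2) with r's first absorption at `e7` and the dual
with r̄'s last emission at `e8 − Y` leave no room once `K > 1` (the text's `|θ|_∞ < 76.3°`). -/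
theorem f15d_prime_p1 {K Y y2 y3 y4 y5 y7 y8 : ℝ} (hK : 1 < K) (hY : 0 < Y)
    (h34 : y3 ≤ y4) (h78 : y7 ≤ y8) (h52 : y5 - y2 ≤ Y)
    (hep : K * (Y + y4 - y5) ≤ y7 - y4) (hdu : K * (Y + y2 - y3) ≤ Y + y3 - y8) : False := by
  have hZ : Y ≤ 2 * Y - (y5 - y4) - (y3 - y2) := by linarith
  have hZ0 : 0 < 2 * Y - (y5 - y4) - (y3 - y2) := by linarith
  have hlt : 1 * (2 * Y - (y5 - y4) - (y3 - y2)) < K * (2 * Y - (y5 - y4) - (y3 - y2)) :=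
    mul_lt_mul_of_pos_right hK hZ0
  have hsum : K * (2 * Y - (y5 - y4) - (y3 - y2)) ≤ Y + (y3 - y4) + (y7 - y8) := by
    have : K * (2 * Y - (y5 - y4) - (y3 - y2)) = K * (Y + y4 - y5) + K * (Y + y2 - y3) := by ring
    linarith
  linarith

/-- F15d′ (exact events), p = 2 walk of record (episode `e8 → e6 + Y`, first absorption `e11`; dual
`e5 → e3 + Y`, last emission `e12 − Y`). -/
theorem f15d_prime_p2 {K Y y3 y5 y6 y8 y11 y12 : ℝ} (hK : 1 < K) (hY : 0 < Y)
    (h56 : y5 ≤ y6) (h1112 : y11 ≤ y12) (h83 : y8 - y3 ≤ Y)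
    (hep : K * (Y + y6 - y8) ≤ y11 - y6) (hdu : K * (Y + y3 - y5) ≤ Y + y5 - y12) : False := by
  have hZ0 : 0 < 2 * Y - (y8 - y6) - (y5 - y3) := by linarith
  have hlt : 1 * (2 * Y - (y8 - y6) - (y5 - y3)) < K * (2 * Y - (y8 - y6) - (y5 - y3)) :=
    mul_lt_mul_of_pos_right hK hZ0
  have hsum : K * (2 * Y - (y8 - y6) - (y5 - y3)) ≤ Y + (y5 - y6) + (y11 - y12) := by
    have : K * (2 * Y - (y8 - y6) - (y5 - y3)) = K * (Y + y6 - y8) + K * (Y + y3 - y5) := by ring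
    linarith
  linarith

/-- `K·cos⁻²θ_∞ = (d+u)/η₂ = 18` at the sizes of record `(d, t, u) = (.2, .18, .16)`. -/
theorem K_at_record_sizes : ((0.2 : ℝ) + 0.16) / (0.18 - 0.16) = 18 := by norm_num

end Summit.NavierStokesRegularity.FunctionalMining.TwoNotch
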